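import Summits.Ventures.Crystal3D.Theorems.StickyWulffConstantCoaxialWallLawSeamFullCensusFreeBall
import Summits.Ventures.Crystal3D.Theorems.StickyWulffConstantCoaxialWallLawSeamDozenVacancyCensus
import HarnessLib

/-!
# FULL-CENSUS TWIN-VACANCY LEAF: «twin dozen of the end ball minus one mirror» ⇒ two unsaturated contacts (modulo `VacancyCapTwin`), in four symmetric variants
# (crux `CoaxialWallLaw`, stmt-Ventures-19481; lane F 'Certificates' v8.4, registered stub `stub_satCensus11Full : TailResidue.SatCensus11Full`)

HONEST FRAMING. Venture `Summits/Ventures/Crystal3D` (cell `crystal3d-full`); helper for `stub_satCensus11Full`; sequel of '…SeamFullCensusFreeBall'.  The only leaves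
of the E1 cascade that E1 cannot close (seat 19481-p2 g15, exact search) have the end ball `b` surrounded by the nine own slot balls and two of the three mirror balls of a
twin dozen (normal `(1,1,∓1)`): a coherent twin boundary through `b` with one vacancy above it.  **`false_of_vacLeaf`**: with `deg b = 11` and «any two unsaturated
contacts of `b` coincide» this is impossible — the twin vacancy census '…SeamDozenVacancyCensus' (`two_unsaturated_of_twinVacancyShell`, input `VacancyCapTwin`) gives two
distinct unsaturated contacts.  The four variants (sign of the normal, swap `x ↔ y`) are carried to the standard twin dozen `twinSite` by explicit model reflections
(`Wz`, `Ws`, `reflection_iptQ`).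
WHAT THIS IS NOT: no census statement is proved here; `VacancyCapTwin` stays a named input; F-C1 not moved.
-/

noncomputable section

namespace Summit.Ventures.Crystal3D.Theorems

namespace TailResidue

namespace FullCensus

open Summit.Ventures.Crystal3D Finset EndRowFloor NearIdentity
open scoped InnerProductSpace

variable {X : Finset (EuclideanSpace ℝ (Fin 3))} (G' : EuclideanSpace ℝ (Fin 3) ≃ₗᵢ[ℝ] EuclideanSpace ℝ (Fin 3)) (q₀ : EuclideanSpace ℝ (Fin 3))

/-! ### §3 The twin-vacancy leaf -/

/-- The mirror across the plane orthogonal to `n`: `v ↦ v − (2⟪n,v⟫/‖n‖²) n` (Mathlib's reflection, general `n`). -/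
theorem reflection_orthogonal_apply_div' (n v : EuclideanSpace ℝ (Fin 3)) :
    (ℝ ∙ n)ᗮ.reflection v = v - (2 * ⟪n, v⟫_ℝ / ‖n‖ ^ 2) • n := by
  rw [Submodule.reflection_orthogonal_apply, Submodule.reflection_singleton_apply]
  simp only [RCLike.ofReal_real_eq_id, id_eq, neg_sub]
  rw [two_smul, ← add_smul]
  congr 1
  ring

/-- The model reflection negating the third coordinate. -/
def Wz : EuclideanSpace ℝ (Fin 3) ≃ₗᵢ[ℝ] EuclideanSpace ℝ (Fin 3) := (ℝ ∙ iptQ ![0, 0, 3])ᗮ.reflection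

/-- The model reflection swapping the first two coordinates. -/
def Ws : EuclideanSpace ℝ (Fin 3) ≃ₗᵢ[ℝ] EuclideanSpace ℝ (Fin 3) := (ℝ ∙ iptQ ![3, -3, 0])ᗮ.reflection

/-- A reflection across a rational model normal acts on model points by the rational formula. -/
theorem reflection_iptQ (n v : Fin 3 → ℚ) (hn : dq n n ≠ 0) :
    (ℝ ∙ iptQ n)ᗮ.reflection (iptQ v) = iptQ (v - (2 * dq n v / dq n n) • n) := by
  rw [reflection_orthogonal_apply_div', ← real_inner_self_eq_norm_sq, inner_iptQ, inner_iptQ, iptQ_sub, iptQ_smul]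
  congr 2
  have h : ((dq n n : ℚ) : ℝ) ≠ 0 := by exact_mod_cast hn
  push_cast
  field_simp

/-- `Wz` negates the third model coordinate. -/
theorem Wz_iptQ (a : Q3) : Wz (iptQ a.toV) = iptQ (Q3.toV ⟨a.x, a.y, -a.z⟩) := by
  rw [Wz, reflection_iptQ _ _ (by simp [dq])]
  congr 1
  ext i; fin_cases i <;> simp [Q3.toV, dq]
  ring

/-- `Ws` swaps the first two model coordinates. -/
theorem Ws_iptQ (a : Q3) : Ws (iptQ a.toV) = iptQ (Q3.toV a.swap) := by
  rw [Ws, reflection_iptQ _ _ (by simp [dq])]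
  congr 1
  ext i; fin_cases i <;> simp [Q3.toV, Q3.swap, dq] <;> ring

/-- The coordinate map of the variant `(σ, sw)`: negate the third coordinate when `σ = 1`, then swap the first two when `sw`. -/
def ρ (σ : ℚ) (sw : Bool) (a : Q3) : Q3 :=
  let a' : Q3 := ⟨a.x, a.y, -σ * a.z⟩
  if sw then a'.swap else a'

/-- The model isometry of the variant `(σ, sw)`. -/
def Wv (σ : ℚ) (sw : Bool) : EuclideanSpace ℝ (Fin 3) ≃ₗᵢ[ℝ] EuclideanSpace ℝ (Fin 3) :=
  (if σ = 1 then Wz else LinearIsometryEquiv.refl ℝ _).trans (if sw then Ws else LinearIsometryEquiv.refl ℝ _)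

/-- `Wv` acts on model points by `ρ`. -/
theorem Wv_iptQ {σ : ℚ} (hσ : σ = 1 ∨ σ = -1) (sw : Bool) (a : Q3) : Wv σ sw (iptQ a.toV) = iptQ (ρ σ sw a).toV := by
  have h1 : (if σ = 1 then Wz else LinearIsometryEquiv.refl ℝ _) (iptQ a.toV) = iptQ (Q3.toV ⟨a.x, a.y, -σ * a.z⟩) := by
    rcases hσ with rfl | rfl
    · rw [if_pos rfl, Wz_iptQ]; simp
    · rw [if_neg (by norm_num)]; simp
  unfold Wv ρ
  rw [LinearIsometryEquiv.trans_apply, h1]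
  cases sw
  · simp
  · simp [Ws_iptQ]

/-- The twin dozen as model triples. -/
def twinQ3 (l : Fin 12) : Q3 := ⟨twinInt l 0, twinInt l 1, twinInt l 2⟩

/-- Cubic coordinates carry the twin dozen to the model points `twinInt l` (scale `√18`). -/
theorem Cc_twinSite (l : Fin 12) : Cc (twinSite l) = iptQ (twinQ3 l).toV := by
  have h18 : Real.sqrt 18 = 3 * Real.sqrt 2 := by
    rw [show (18 : ℝ) = 3 ^ 2 * 2 by norm_num, Real.sqrt_mul (by norm_num), Real.sqrt_sq (by norm_num)]
  ext i
  rw [Cc_apply, cubicCoords_twinSite, iptQ_apply, h18]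
  fin_cases i <;> simp [Q3.toV, twinQ3, div_eq_inv_mul]

/-- The twelve positions of the leaf's twin dozen around `b`. -/
def vacPos (σ : ℚ) (sw : Bool) (l : Fin 12) : Q3 := ρ σ sw (Q3.add bQ (twinQ3 l))

/-- `ρ` fixes the end ball and is additive, so `vacPos = ρ (b + twin)`; here the bookkeeping we need: `ρ σ sw bQ = bQ`. -/
theorem ρ_bQ {σ : ℚ} (sw : Bool) : ρ σ sw bQ = bQ := by
  cases sw <;> simp [ρ, bQ, Q3.swap]

/-- `ρ` is additive. -/
theorem ρ_add (σ : ℚ) (sw : Bool) (a c : Q3) : ρ σ sw (Q3.add a c) = Q3.add (ρ σ sw a) (ρ σ sw c) := by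
  cases sw <;> simp [ρ, Q3.add, Q3.swap] <;> ring

/-- Table: the eleven positions other than the vacancy `l = 11` are the leaf's eleven balls (both signs). -/
theorem vacPos_mem : ∀ σ ∈ [(1 : ℚ), -1], ∀ sw : Bool, ∀ l : Fin 12, l ≠ 11 →
    vacPos σ sw l ∈ (elevenList σ).map (fun v => if sw then v.swap else v) := by
  decide +kernel

/-- Table: the twelve positions are distinct model contacts of `b`. -/
theorem vacPos_table : ∀ σ ∈ [(1 : ℚ), -1], ∀ sw : Bool,
    ((List.finRange 12).map (vacPos σ sw)).Nodup ∧ ∀ l : Fin 12, Q3.d2 bQ (vacPos σ sw l) = 18 := by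
  decide +kernel

open scoped Classical in
/-- **THE TWIN-VACANCY LEAF.**  Under GAP(5/2) and `VacancyCapTwin`: if `b = TT bQ ∈ X` has exactly eleven contacts, at most one of them unsaturated, then the eleven
balls «twin dozen of `b` (normal `(1,1,−σ)`) minus the mirror `b + (4,1,−σ)`» (optionally swapped `x ↔ y`) cannot all be present. -/
theorem false_of_vacLeaf (hg : KissingGap (5 / 2)) (hcap : VacancyCapTwin) (hX : ∀ p ∈ X, ∀ p' ∈ X, p ≠ p' → 1 ≤ dist p p')
    (hb : TT G' q₀ bQ ∈ X) (h11 : (X.filter fun z => dist (TT G' q₀ bQ) z = 1).card = 11)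
    (hH : ∀ y ∈ X, ∀ y' ∈ X, dist (TT G' q₀ bQ) y = 1 → dist (TT G' q₀ bQ) y' = 1 →
      (X.filter fun z => dist y z = 1).card ≤ 11 → (X.filter fun z => dist y' z = 1).card ≤ 11 → y = y')
    {σ : ℚ} (hσ : σ = 1 ∨ σ = -1) (sw : Bool) (hpres : ∀ v ∈ elevenList σ, TT G' q₀ (if sw then v.swap else v) ∈ X) : False := by
  have hσmem : σ ∈ [(1 : ℚ), -1] := by rcases hσ with rfl | rfl <;> simp
  -- the frame of the leaf's twin dozen
  set A : EuclideanSpace ℝ (Fin 3) ≃ₗᵢ[ℝ] EuclideanSpace ℝ (Fin 3) := Cc.trans ((Wv σ sw).trans (Qr.trans G')) with hA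
  have hpos : ∀ l : Fin 12, TT G' q₀ bQ + A (twinSite l) = TT G' q₀ (vacPos σ sw l) := by
    intro l
    rw [hA, LinearIsometryEquiv.trans_apply, LinearIsometryEquiv.trans_apply, LinearIsometryEquiv.trans_apply, Cc_twinSite, Wv_iptQ hσ, vacPos,
      ρ_add, ρ_bQ, TT_add]
  obtain ⟨hnd, hcontact⟩ := vacPos_table σ hσmem sw
  -- the eleven are present
  have hocc : ∀ l : Fin 12, l ≠ 11 → TT G' q₀ bQ + A (twinSite l) ∈ X := by
    intro l hl
    rw [hpos]
    have hm := vacPos_mem σ hσmem sw l hl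
    rw [List.mem_map] at hm
    obtain ⟨v, hv, he⟩ := hm
    rw [← he]; exact hpres v hv
  -- the twelfth is absent: otherwise twelve contacts
  have hvac : TT G' q₀ bQ + A (twinSite 11) ∉ X := by
    intro h12th
    rw [hpos] at h12th
    refine false_of_twelve_contacts G' q₀ (((List.finRange 12).map (vacPos σ sw)).map Q3.toV) ((List.nodup_map_iff Q3.toV_injective).2 hnd)
      (by simp) (fun v hv => ?_) (fun v hv => ?_) h11
    · rw [List.mem_map] at hv
      obtain ⟨p, hp, rfl⟩ := hv
      rw [List.mem_map] at hp
      obtain ⟨l, -, rfl⟩ := hp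
      by_cases hl : l = 11
      · rw [hl]; exact h12th
      · have := hocc l hl; rwa [hpos] at this
    · rw [List.mem_map] at hv
      obtain ⟨p, hp, rfl⟩ := hv
      rw [List.mem_map] at hp
      obtain ⟨l, -, rfl⟩ := hp
      rw [Q3.dq_toV_sub]; exact hcontact l
  obtain ⟨y, hy, y', hy', hne, hd, hd', hc, hc'⟩ := two_unsaturated_of_twinVacancyShell hg hcap hX A hb hocc hvac
  exact hne (hH y hy y' hy' hd hd' hc hc')

end FullCensus

end TailResidue

end Summit.Ventures.Crystal3D.Theorems

end
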